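import Summits.ResolutionOfSingularities.ResolutionOfSingularities.Theorems.FrobeniusLadderFRationalResolutionChartFace
import Summits.ResolutionOfSingularities.ResolutionOfSingularities.Theorems.FrobeniusLadderFRationalResolutionSaturatedIdealsLocalize
import Summits.ResolutionOfSingularities.ResolutionOfSingularities.Theorems.FrobeniusLadderFRationalResolutionOffSupportDegrees
import Mathlib.RingTheory.Localization.Ideal
import HarnessLib

/-!
# Crux `FrobeniusLadder.FRationalResolution` (stmt-ResolutionOfSingularities-15317), line `redirect`,
# stub `stub_diagonalizableQuotientResolution` — KATO'S IDEAL of the fixed-point chart at a nearby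
# prime coincides, after localisation, with the contracted stratum ideal (item (C1) of the packaging
# step, memo MEMO-15317-leafhand2-g3 §8)

At `𝔮' = 𝔔' ∩ S₀` the chart `φ : P → S₀`, `φ(m) = x^m`, has Kato ideal
`K = (x^m : m ∈ P, x^m ∈ 𝔮')` (`LogChart.ideal`); the descent chain (`…StratumDescentGradeZero`)
delivers regularity modulo `J' = ((x_I)S[e⁻¹]) ∩ S₀`, `I = {i : xᵢ ∈ 𝔔'}`. Here: `K ⊆ J'`, and every
`r ∈ J'` has `(g eᵐ) r ∈ K` (`eᵐ r ∈ (x_I)S ∩ S₀` by the localisation, then `…FixedPointContraction`: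
`g • ((x_I)S ∩ S₀)` lies in the `S₀`-span of the degree-zero monomials in `(x_I)`, which are chart
elements lying in `𝔮'`). Hence `K` and `J'` generate the same ideal of `(S₀)_𝔮'`
(`…SaturatedIdealsLocalize`).

* `chart_mem_stratum_of_mem` — a chart element `x^m ∈ 𝔮'` lies in `(x_I)S`;
* `monomial_eq_chart` — a non-zero degree-`0` monomial in `(x_I)S` is a chart element lying in `𝔮'`;
* **`kato_ideal_map_eq_stratum_map`** — `K (S₀)_𝔮' = J' (S₀)_𝔮'` (any localization `Rq` at `𝔮'`).

Honest label: chart bookkeeping (no stub closed). No definitions, no named facts, no sorry.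
[folklore; cite: Kato1994, Def. (2.1)]
-/

noncomputable section

-- single-problem summit: the doubled namespace component is forced
set_option linter.dupNamespace false

open Literature.AlgebraicGeometry.Resolution DirectSum

namespace Summit.ResolutionOfSingularities.ResolutionOfSingularities.Theorems.FRationalResolution.ChartKatoIdeal

universe u v w

variable {k : Type u} [Field k] {A : Type w} [DecidableEq A] [AddCommGroup A] {S : Type u}
  [CommRing S] [Algebra k S] (𝒮 : A → Submodule k S) [GradedAlgebra 𝒮]
  {n : ℕ} (x : Fin n → S) (a : Fin n → A) (hx : ∀ i, x i ∈ 𝒮 (a i))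
  (φ : Multiplicative ↥(AddSubmonoid.nonneg (Fin n → ℤ) ⊓
      AddMonoidHom.mker (Fintype.linearCombination ℤ a).toAddMonoidHom) →* 𝒮 0)
  (hφ : ∀ p, ((φ (Multiplicative.ofAdd p) : 𝒮 0) : S) = ∏ i, x i ^ ((p : Fin n → ℤ) i).toNat)
  (𝔔' : Ideal S) [𝔔'.IsPrime] (I : Finset (Fin n)) (hI : ∀ i, i ∈ I ↔ x i ∈ 𝔔')

include hφ hI in
/-- A chart element `x^m` lying in `𝔔'` lies in the stratum ideal `(xᵢ : i ∈ I)`, `I = {i : xᵢ ∈ 𝔔'}`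
(some `xᵢ ∈ 𝔔'` divides it, by primality). [folklore] -/
theorem chart_mem_stratum_of_mem (p : ↥(AddSubmonoid.nonneg (Fin n → ℤ) ⊓
      AddMonoidHom.mker (Fintype.linearCombination ℤ a).toAddMonoidHom))
    (hp : ((φ (Multiplicative.ofAdd p) : 𝒮 0) : S) ∈ 𝔔') :
    ((φ (Multiplicative.ofAdd p) : 𝒮 0) : S) ∈ Ideal.span (x '' (↑I : Set (Fin n))) := by
  classical
  rw [hφ] at hp ⊢
  by_contra hnot
  have h : ¬ (∏ i, x i ^ ((p : Fin n → ℤ) i).toNat ∉ 𝔔') := fun h => h hp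
  rw [ChartFace.prod_pow_not_mem_iff 𝔔' x] at h
  push Not at h
  obtain ⟨i, hmi, hxi⟩ := h
  apply hnot
  have hdvd : x i ∣ ∏ j, x j ^ ((p : Fin n → ℤ) j).toNat :=
    (dvd_pow_self (x i) hmi).trans (Finset.dvd_prod_of_mem _ (Finset.mem_univ i))
  obtain ⟨y, hy⟩ := hdvd
  rw [hy]
  exact Ideal.mul_mem_right y _ (Ideal.subset_span ⟨i, (hI i).mpr hxi, rfl⟩)

omit [𝔔'.IsPrime] in
include hx hφ hI in
/-- A NON-ZERO degree-zero monomial in `(x_I)S` is a chart element `φ(m)` with `φ(m) ∈ 𝔮' = 𝔔' ∩ S₀`.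
[folklore] -/
theorem monomial_eq_chart {μ : S} (hμ : μ ∈ Submonoid.closure (Set.range x)) (hμ0 : μ ∈ 𝒮 0)
    (hμI : μ ∈ Ideal.span (x '' (↑I : Set (Fin n)))) (hne : μ ≠ 0) :
    ∃ p : ↥(AddSubmonoid.nonneg (Fin n → ℤ) ⊓
        AddMonoidHom.mker (Fintype.linearCombination ℤ a).toAddMonoidHom),
      ((φ (Multiplicative.ofAdd p) : 𝒮 0) : S) = μ ∧
        φ (Multiplicative.ofAdd p) ∈ 𝔔'.comap (algebraMap (𝒮 0) S) := by
  classical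
  obtain ⟨m, rfl⟩ := (Submonoid.mem_closure_range_iff_of_fintype (f := x) (x := μ)).mp hμ
  have hdeg : ∏ i, x i ^ m i ∈ 𝒮 (∑ i, m i • a i) :=
    SetLike.prod_pow_mem_graded 𝒮 (F := Finset.univ) (i := a) (g := x) m fun i _ => hx i
  have hsum : ∑ i, m i • a i = 0 := (DirectSum.degree_eq_of_mem_mem 𝒮 hdeg hμ0 hne)
  let v : Fin n → ℤ := fun i => (m i : ℤ)
  have hvnn : (0 : Fin n → ℤ) ≤ v := fun i => show (0 : ℤ) ≤ (m i : ℤ) from Int.natCast_nonneg _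
  have hvdeg : Fintype.linearCombination ℤ a v = 0 := by
    rw [Fintype.linearCombination_apply, ← hsum]
    refine Finset.sum_congr rfl fun i _ => ?_
    exact natCast_zsmul (a i) (m i)
  let p : ↥(AddSubmonoid.nonneg (Fin n → ℤ) ⊓
      AddMonoidHom.mker (Fintype.linearCombination ℤ a).toAddMonoidHom) :=
    ⟨v, AddSubmonoid.mem_inf.mpr ⟨AddSubmonoid.mem_nonneg.mpr hvnn,
      AddMonoidHom.mem_mker.mpr (show (Fintype.linearCombination ℤ a).toAddMonoidHom v = 0 from
        hvdeg)⟩⟩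
  have hφp : ((φ (Multiplicative.ofAdd p) : 𝒮 0) : S) = ∏ i, x i ^ m i := by
    rw [hφ]
    refine Finset.prod_congr rfl fun i _ => ?_
    simp [p, v]
  refine ⟨p, hφp, ?_⟩
  rw [Ideal.mem_comap, show algebraMap (𝒮 0) S (φ (Multiplicative.ofAdd p)) =
    ((φ (Multiplicative.ofAdd p) : 𝒮 0) : S) from rfl, hφp]
  exact (Ideal.span_le.mpr (by rintro _ ⟨i, hi, rfl⟩; exact (hI i).mp hi) : _ ≤ 𝔔') hμI

include hx hφ hI in
/-- **Kato's ideal and the contracted stratum ideal agree in `(S₀)_𝔮'`.** With `K` Kato's ideal of the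
chart at `𝔮' = 𝔔' ∩ S₀` (`LogChart.ideal`), `L` a localization of `S` at the powers of `e ∈ S₀ ∖ 𝔔'`,
`J' = ((x_I)L) ∩ S₀`, and `g ∈ S₀ ∖ 𝔔'` with the contraction property of `…FixedPointContraction`
(`g • ((x_I)S ∩ S₀) ⊆` span of the degree-zero monomials in `(x_I)`): `K R = J' R` for every
localization `R` of `S₀` at `𝔮'`. [folklore; cite: Kato1994, Def. (2.1)] -/
theorem kato_ideal_map_eq_stratum_map (g : 𝒮 0) (hg : (g : S) ∉ 𝔔')
    (hd : ∀ r : S, r ∈ 𝒮 0 → r ∈ Ideal.span (x '' (↑I : Set (Fin n))) →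
      (g : S) * r ∈ Submodule.span (𝒮 0) {μ : S | μ ∈ Submonoid.closure (Set.range x) ∧ μ ∈ 𝒮 0 ∧
        μ ∈ Ideal.span (x '' (↑I : Set (Fin n)))})
    (e : 𝒮 0) (he : (e : S) ∉ 𝔔')
    (L : Type u) [CommRing L] [Algebra S L] [IsLocalization (Submonoid.powers (e : S)) L]
    (Rq : Type v) [CommRing Rq] [Algebra (𝒮 0) Rq]
    [IsLocalization.AtPrime Rq (𝔔'.comap (algebraMap (𝒮 0) S))] :
    (LogChart.ideal _ φ (𝔔'.comap (algebraMap (𝒮 0) S))).map (algebraMap (𝒮 0) Rq) =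
      (((Ideal.span (x '' (↑I : Set (Fin n)))).map (algebraMap S L)).comap
        ((algebraMap S L).comp (algebraMap (𝒮 0) S))).map (algebraMap (𝒮 0) Rq) := by
  classical
  set IS : Ideal S := Ideal.span (x '' (↑I : Set (Fin n))) with hIS
  set 𝔮 : Ideal (𝒮 0) := 𝔔'.comap (algebraMap (𝒮 0) S) with h𝔮
  set K : Ideal (𝒮 0) := LogChart.ideal _ φ 𝔮 with hK
  set J' : Ideal (𝒮 0) := (IS.map (algebraMap S L)).comap
    ((algebraMap S L).comp (algebraMap (𝒮 0) S)) with hJ'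
  haveI h𝔮p : 𝔮.IsPrime := Ideal.IsPrime.comap _
  -- `K ≤ J'`
  have hKJ : K ≤ J' := by
    rw [hK, LogChart.ideal]
    refine Ideal.span_le.mpr ?_
    rintro _ ⟨p, hp, rfl⟩
    show φ (Multiplicative.ofAdd p) ∈ J'
    rw [hJ', Ideal.mem_comap, RingHom.comp_apply]
    exact Ideal.mem_map_of_mem _ (chart_mem_stratum_of_mem 𝒮 x a φ hφ 𝔔' I hI p hp)
  -- the `S₀`-span of the degree-zero monomials in `(x_I)` maps into `K`
  set G : Set (𝒮 0) := (fun p => φ (Multiplicative.ofAdd p)) ''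
    {p | φ (Multiplicative.ofAdd p) ∈ 𝔮} with hG
  have hKspan : K = Ideal.span G := rfl
  have hmap : Submodule.span (𝒮 0) {μ : S | μ ∈ Submonoid.closure (Set.range x) ∧ μ ∈ 𝒮 0 ∧
      μ ∈ IS} ≤ Submodule.map (Algebra.linearMap (𝒮 0) S) K := by
    refine Submodule.span_le.mpr ?_
    rintro μ ⟨hμ, hμ0, hμI⟩
    by_cases hne : μ = 0
    · rw [hne]; exact Submodule.zero_mem _
    obtain ⟨p, hpμ, hp𝔮⟩ := monomial_eq_chart 𝒮 x a hx φ hφ 𝔔' I hI hμ hμ0 hμI hne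
    refine ⟨φ (Multiplicative.ofAdd p), ?_, hpμ⟩
    rw [hKspan]
    exact Ideal.subset_span ⟨p, hp𝔮, rfl⟩
  -- saturation: `r ∈ J' ⇒ (g eᵐ) r ∈ K`
  have hsat : ∀ r ∈ J', ∃ t ∉ 𝔮, t * r ∈ K := by
    intro r hr
    rw [hJ', Ideal.mem_comap, RingHom.comp_apply,
      IsLocalization.algebraMap_mem_map_algebraMap_iff (Submonoid.powers (e : S))] at hr
    obtain ⟨_, ⟨m, rfl⟩, hm⟩ := hr
    -- `eᵐ r ∈ (x_I)S ∩ S₀`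
    have hemr0 : (e : S) ^ m * (r : S) ∈ 𝒮 0 := by
      have h := SetLike.mul_mem_graded (SetLike.pow_mem_graded m e.2) r.2
      rwa [smul_zero, zero_add] at h
    have hd' := hd _ hemr0 hm
    obtain ⟨y, hyK, hy⟩ := hmap hd'
    refine ⟨g * e ^ m, fun h => (h𝔮p.mem_or_mem h).elim
      (fun hg' => hg (Ideal.mem_comap.mp hg')) (fun he' => he (‹𝔔'.IsPrime›.mem_of_pow_mem m
        (by have := Ideal.mem_comap.mp he'; simpa using this))), ?_⟩
    have hyeq : y = g * e ^ m * r := by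
      apply Subtype.val_injective
      simp only [Algebra.linearMap_apply] at hy
      rw [show algebraMap (𝒮 0) S y = (y : S) from rfl] at hy
      rw [hy, SetLike.GradeZero.coe_mul, SetLike.GradeZero.coe_mul, SetLike.GradeZero.coe_pow,
        mul_assoc]
    rw [← hyeq]
    exact hyK
  exact SaturatedIdealsLocalize.map_eq_map_of_forall_exists_mul_mem 𝔮 Rq hKJ hsat

end Summit.ResolutionOfSingularities.ResolutionOfSingularities.Theorems.FRationalResolution.ChartKatoIdeal

end
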